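import Literature.NumberTheory.DiophantineGeometry.GLHighestWeightIsomorphismProofs
import Literature.NumberTheory.DiophantineGeometry.GLPolynomialRepSemisimpleProofs
import Mathlib.LinearAlgebra.Dual.Lemmas
import Mathlib.Algebra.CharZero.Infinite
import HarnessLib

/-!
# Multiplicity of an irreducible representation of `GL_n` = dimension of the space of
# highest-weight vectors (discharge of `hwMultiplicity_eq_finrank_intertwiningMap`)

`GLHighestWeight.lean` records, as the named fact
`Literature.NumberTheory.DiophantineGeometry.hwMultiplicity_eq_finrank_intertwiningMap`, the
statement certifying that `hwMultiplicity ρ χ = dim {v | ρ(b) v = χ(b) v for all b ∈ B}` is the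
multiplicity of the irreducible representation of highest weight `χ` in `ρ`: for an irreducible
rational representation `W` of `GL σ k` of highest weight `χ` and a finite-dimensional rational
representation `V` (algebraically closed field of characteristic zero),
`hwMultiplicity ρ χ = dim Hom_{GL}(W, V)`. This is Goodman–Wallach, *Symmetry, Representations,
and Invariants*, eq. (4.26) in the proof of Thm. 4.2.12 (PDF p. 300 of the held text):
"`mult_V(π^μ) = dim V^{𝔫⁺}(μ)`", where the multiplicity of §4.1.6 (p. 281) is
"`m_V(λ) = dim Hom_𝒜(F^λ, V)`"; the printed proof counts both sides over an isotypic decomposition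
`V_(μ) = V_{μ,1} ⊕ ⋯ ⊕ V_{μ,d(μ)}` (complete reducibility, Thm. 3.3.12, and Cor. 3.3.14,
`dim V^{𝔫⁺} = 1` for an irreducible `V`).

This file **proves** the fact (`hwMultiplicity_eq_finrank_intertwiningMap_holds`) from the
results already in the tree, by exhibiting the isomorphism behind the count instead of
decomposing: for a nonzero highest-weight vector `v₀ ∈ W` the evaluation map

  `ev : Hom_{GL}(W, V) → V^B_χ`, `f ↦ f v₀`

is a linear bijection. It is injective by Schur's lemma (`W` irreducible, Mathlib
`Representation.IsIrreducible.injective_or_eq_zero`). It is surjective because for a nonzero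
highest-weight vector `v ∈ V` of weight `χ` the stable subspace `U = span (G · v)` is irreducible
(`isIrreducible_toRepresentation_span_orbit`: `V` is completely reducible —
`isSemisimpleRepresentation_of_isRationalRep_holds`, file `GLPolynomialRepSemisimpleProofs` — and a
decomposition `U = U' ⊕ U''` splits `v` into highest-weight vectors of weight `χ` inside
`U = span (U⁻ · v)`, whose weight-`χ` vectors form the line `k v` —
`span_orbit_eq_lowerSpan`, `exists_eq_smul_of_mem_lowerSpan_of_mem_weightSpace`, file
`GLHighestWeightIsomorphismProofs`; this is the group form of Goodman–Wallach Prop. 3.3.9, "a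
finite-dimensional highest-weight module is irreducible"), hence `U ≅ W` by the theorem of the
highest weight (`nonempty_equiv_of_mem_highestWeightSpace`), and the isomorphism `W → U ⊆ V` maps
`v₀` to a nonzero multiple of `v` (`highestWeightSpace_le_span_singleton`). The proof uses
`IsAlgClosed k` and `CharZero k` only through `Infinite k` and complete reducibility.

## References

* R. Goodman, N. R. Wallach, *Symmetry, Representations, and Invariants*, GTM 255, Springer
  (2009): §4.1.6 (multiplicities, p. 281), Thm. 4.2.12 with eq. (4.26) (p. 300), Prop. 3.3.9
  (p. 262), Cor. 3.3.14 (p. 266) of the held text. [GoodmanWallachGTM255]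
* W. Fulton, J. Harris, *Representation Theory. A First Course*, GTM 129 (1991), §15.5.
  [FultonHarrisGTM129]

## Mathlib and tree

Mathlib: `Subrepresentation` (`toRepresentation`, lattice and `⊤/⊥`), `Representation.IntertwiningMap`
(`comp`, `smul_apply`, module structure), `Representation.Equiv`,
`Representation.IsIrreducible.injective_or_eq_zero`, `exists_isCompl` (complemented lattice),
`Subspace.dualLift`, `LinearEquiv.ofBijective`, `LinearEquiv.finrank_eq`. Mathlib has no
highest-weight theory for the group `GL_n` (see `GLHighestWeight`). Tree: `highestWeightSpace`,
`weightSpace`, `hwMultiplicity`, `HasHighestWeight`, `IsRationalRep`, the named fact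
(`GLHighestWeight`); `apply_mem_span_orbit`, `lowerSpan`, `span_orbit_eq_lowerSpan`,
`exists_eq_smul_of_mem_lowerSpan_of_mem_weightSpace`, `nonempty_equiv_of_mem_highestWeightSpace`,
`highestWeightSpace_le_span_singleton` (`GLHighestWeightIsomorphismProofs`);
`isSemisimpleRepresentation_toRepresentation`, `isSemisimpleRepresentation_of_isRationalRep_holds`
(`GLPolynomialRepSemisimpleProofs`). Nothing is restated; no new definitions.

## Design

Same variables as `GLHighestWeight` (`[Fintype σ] [LinearOrder σ] [Field k]`). The auxiliary
results are stated in the generality their proofs give (`[Infinite k]`, resp. `[CharZero k]` where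
complete reducibility is used); the discharge itself has exactly the binders of the named fact.
-/

noncomputable section

open scoped BigOperators

namespace Literature.NumberTheory.DiophantineGeometry

variable {σ : Type*} [Fintype σ] [LinearOrder σ] {k : Type*} [Field k]
variable {V W : Type*} [AddCommGroup V] [Module k V] [AddCommGroup W] [Module k W]

/-! ### Subrepresentations: rationality and highest-weight vectors -/

section Subrep

/-- A subrepresentation of a rational representation is rational: a matrix coefficient
`g ↦ φ(ρ(g) x)` of `ρ|_U` is the matrix coefficient of `ρ` for any linear extension of `φ` to `V`
(Mathlib `Subspace.dualLift`). Goodman–Wallach §1.5 (regular representations and their invariant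
subspaces). [folklore] -/
theorem IsRationalRep.toRepresentation {ρ : Representation k (GL σ k) V} (hρ : IsRationalRep ρ)
    (U : Subrepresentation ρ) : IsRationalRep U.toRepresentation := by
  intro x φ
  obtain ⟨P, r, hP⟩ := hρ (x : V) (Subspace.dualLift U.toSubmodule φ)
  refine ⟨P, r, fun g => ?_⟩
  rw [← hP g, Subspace.dualLift_of_mem (U.apply_mem_toSubmodule g x.2)]
  rfl

/-- The highest-weight vectors of weight `χ` of a subrepresentation `U ⊆ V` are the highest-weight
vectors of weight `χ` of `V` lying in `U`. Goodman–Wallach §3.2.1. [folklore] -/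
theorem mem_highestWeightSpace_toRepresentation_iff {ρ : Representation k (GL σ k) V}
    (U : Subrepresentation ρ) (χ : Weight σ) (x : U.toSubmodule) :
    x ∈ highestWeightSpace U.toRepresentation χ ↔ (x : V) ∈ highestWeightSpace ρ χ := by
  simp only [mem_highestWeightSpace_iff]
  refine forall₂_congr fun g _ => ?_
  rw [Subtype.ext_iff, Submodule.coe_smul]
  exact Iff.rfl

/-- The components of a highest-weight vector along a decomposition `V = U₁ ⊕ U₂` into stable
subspaces are highest-weight vectors of the same weight (the projections commute with `ρ(b)`).
Goodman–Wallach §4.2.5 (an intertwiner preserves `V^{𝔫⁺}(μ)`). [folklore] -/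
theorem mem_highestWeightSpace_of_isCompl {ρ : Representation k (GL σ k) V}
    {U₁ U₂ : Subrepresentation ρ} (h : IsCompl U₁ U₂) {χ : Weight σ} {x₁ x₂ : V}
    (hx₁ : x₁ ∈ U₁.toSubmodule) (hx₂ : x₂ ∈ U₂.toSubmodule)
    (hx : x₁ + x₂ ∈ highestWeightSpace ρ χ) : x₁ ∈ highestWeightSpace ρ χ := by
  have hdisj : Disjoint U₁.toSubmodule U₂.toSubmodule := by
    rw [disjoint_iff]
    exact congrArg Subrepresentation.toSubmodule (disjoint_iff.mp h.disjoint)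
  intro b hb
  have h1 := hx b hb
  rw [map_add, smul_add] at h1
  have hm₁ : ρ b x₁ - weightChar χ b • x₁ ∈ U₁.toSubmodule :=
    U₁.toSubmodule.sub_mem (U₁.apply_mem_toSubmodule b hx₁) (U₁.toSubmodule.smul_mem _ hx₁)
  have hm₂ : weightChar χ b • x₂ - ρ b x₂ ∈ U₂.toSubmodule :=
    U₂.toSubmodule.sub_mem (U₂.toSubmodule.smul_mem _ hx₂) (U₂.apply_mem_toSubmodule b hx₂)
  have heq : ρ b x₁ - weightChar χ b • x₁ = weightChar χ b • x₂ - ρ b x₂ := by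
    rw [sub_eq_sub_iff_add_eq_add, h1, add_comm]
  rw [← heq] at hm₂
  rw [← sub_eq_zero]
  exact (Submodule.disjoint_def.mp hdisj) _ hm₁ hm₂

/-- **The stable subspace generated by a highest-weight vector of a completely reducible rational
representation is irreducible** (over an infinite field). If `U = span (G · v)` splits as
`U = U' ⊕ U''` into stable subspaces, the components `v', v''` of `v` are highest-weight vectors of
weight `χ` lying in `U = span (U⁻ · v)` (`span_orbit_eq_lowerSpan`), whose weight-`χ` vectors are
the multiples of `v` (`exists_eq_smul_of_mem_lowerSpan_of_mem_weightSpace`); so `v ∈ U'` (and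
`U' = U`) unless `v' = 0`, in which case `v ∈ U''`, `U'' = U` and `U' = 0`. This is the group form
of Goodman–Wallach Prop. 3.3.9 ("a finite-dimensional highest-weight module is irreducible").
[folklore] -/
theorem isIrreducible_toRepresentation_span_orbit [Infinite k] {ρ : Representation k (GL σ k) V}
    (hρ : IsRationalRep ρ) (hss : ρ.IsSemisimpleRepresentation) {χ : Weight σ} {v : V}
    (hv : v ∈ highestWeightSpace ρ χ) (hv0 : v ≠ 0) (U : Subrepresentation ρ)
    (hU : U.toSubmodule = Submodule.span k (Set.range fun g : GL σ k => ρ g v)) :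
    U.toRepresentation.IsIrreducible := by
  have hvU : v ∈ U.toSubmodule := by
    rw [hU]
    exact Submodule.subset_span ⟨1, show ρ 1 v = v by rw [map_one, Module.End.one_apply]⟩
  set x : U.toSubmodule := ⟨v, hvU⟩ with hxdef
  have hx0 : x ≠ 0 := fun h => hv0 (congrArg Subtype.val h)
  -- a stable subspace of `U` containing `v` is all of `U`
  have htop : ∀ U' : Subrepresentation U.toRepresentation, x ∈ U'.toSubmodule → U' = ⊤ := by
    intro U' hxU'
    apply Subrepresentation.toSubmodule_injective
    change U'.toSubmodule = ⊤
    rw [eq_top_iff]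
    rintro y -
    have hle : Submodule.span k (Set.range fun g : GL σ k => ρ g v) ≤
        U'.toSubmodule.map U.toSubmodule.subtype := by
      rw [Submodule.span_le]
      rintro _ ⟨g, rfl⟩
      exact ⟨U.toRepresentation g x, U'.apply_mem_toSubmodule g hxU', rfl⟩
    have hy : (y : V) ∈ U'.toSubmodule.map U.toSubmodule.subtype := by
      refine hle ?_
      rw [← hU]
      exact y.2
    obtain ⟨y', hy', hyy'⟩ := hy
    have hy'y : y' = y := Subtype.ext hyy'
    rw [← hy'y]
    exact hy'
  haveI : Nontrivial (Subrepresentation U.toRepresentation) := by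
    refine ⟨⟨⊥, ⊤, fun h => hx0 ?_⟩⟩
    have h' : x ∈ (⊥ : Subrepresentation U.toRepresentation).toSubmodule := by
      rw [h]
      trivial
    exact (Submodule.mem_bot k).mp h'
  refine ⟨fun U' => ?_⟩
  -- a stable complement of `U'` inside the completely reducible `U`
  haveI hssU : U.toRepresentation.IsSemisimpleRepresentation :=
    isSemisimpleRepresentation_toRepresentation U hss
  obtain ⟨U'', hc⟩ := exists_isCompl U'
  have hsup : U'.toSubmodule ⊔ U''.toSubmodule = ⊤ :=
    congrArg Subrepresentation.toSubmodule (codisjoint_iff.mp hc.codisjoint)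
  have hxtop : x ∈ U'.toSubmodule ⊔ U''.toSubmodule := by
    rw [hsup]
    trivial
  obtain ⟨x', hx', x'', hx'', hsum⟩ := Submodule.mem_sup.mp hxtop
  -- the components of `x = v` are highest-weight vectors of weight `χ` ...
  have hxhw : x ∈ highestWeightSpace U.toRepresentation χ :=
    (mem_highestWeightSpace_toRepresentation_iff U χ x).mpr hv
  have hx'hw : x' ∈ highestWeightSpace U.toRepresentation χ := by
    refine mem_highestWeightSpace_of_isCompl hc hx' hx'' ?_
    rw [hsum]
    exact hxhw
  -- ... inside `span (U⁻ · v)`, hence multiples of `v`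
  have hvwt : v ∈ weightSpace ρ χ := highestWeightSpace_le_weightSpace _ _ hv
  have hx'U : (x' : V) ∈ lowerSpan ρ v := by
    rw [← span_orbit_eq_lowerSpan hρ hv, ← hU]
    exact x'.2
  have hx'wt : (x' : V) ∈ weightSpace ρ χ :=
    highestWeightSpace_le_weightSpace _ _
      ((mem_highestWeightSpace_toRepresentation_iff U χ x').mp hx'hw)
  obtain ⟨c, hcx⟩ := exists_eq_smul_of_mem_lowerSpan_of_mem_weightSpace hρ hvwt hx'U hx'wt
  by_cases hc0 : c = 0
  · -- `x' = 0`: then `x = x'' ∈ U''`, so `U'' = ⊤` and `U' = ⊥`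
    left
    have hx'0 : x' = 0 := Subtype.ext (by rw [hcx, hc0, zero_smul, Submodule.coe_zero])
    rw [hx'0, zero_add] at hsum
    have hU'' : U'' = ⊤ := htop U'' (by rw [← hsum]; exact hx'')
    have hinf := hc.inf_eq_bot
    rwa [hU'', inf_top_eq] at hinf
  · -- `v = c⁻¹ x' ∈ U'`, so `U' = ⊤`
    right
    refine htop U' ?_
    have hxx' : x = c⁻¹ • x' := Subtype.ext (by
      rw [Submodule.coe_smul, hcx, smul_smul, inv_mul_cancel₀ hc0, one_smul])
    rw [hxx']
    exact U'.toSubmodule.smul_mem _ hx'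

end Subrep

/-! ### Highest-weight vectors extend to intertwiners -/

section Extension

/-- **Highest-weight vectors of weight `χ` are the images of `v₀` under intertwiners.** Let `W` be
an irreducible rational representation with a nonzero highest-weight vector `v₀` of weight `χ`,
and `V` a finite-dimensional rational representation (characteristic zero). Every nonzero
highest-weight vector `v ∈ V` of weight `χ` is `f(v₀)` for some intertwiner `f : W → V`: the
stable subspace `U = span (G · v)` is irreducible (`isIrreducible_toRepresentation_span_orbit`,
using complete reducibility `isSemisimpleRepresentation_of_isRationalRep_holds`), hence
isomorphic to `W` (`nonempty_equiv_of_mem_highestWeightSpace`), and an isomorphism `W ≅ U` sends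
`v₀` into the line `k v` of highest-weight vectors of `U` (`highestWeightSpace_le_span_singleton`).
Goodman–Wallach §4.1.6 (the map `S_λ : Hom_𝒜(F^λ, V) ⊗ F^λ → V_(λ)`, Prop. 4.1.15) with
Thm. 4.2.12. [folklore] -/
theorem exists_intertwiningMap_apply_eq [CharZero k] [FiniteDimensional k V]
    {ρW : Representation k (GL σ k) W} [ρW.IsIrreducible] (hW : IsRationalRep ρW) {χ : Weight σ}
    {v₀ : W} (hv₀ : v₀ ∈ highestWeightSpace ρW χ) (hv₀0 : v₀ ≠ 0)
    {ρ : Representation k (GL σ k) V} (hρ : IsRationalRep ρ) {v : V}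
    (hv : v ∈ highestWeightSpace ρ χ) (hv0 : v ≠ 0) :
    ∃ f : ρW.IntertwiningMap ρ, f v₀ = v := by
  -- the stable subspace generated by `v`
  let U : Subrepresentation ρ :=
    ⟨Submodule.span k (Set.range fun g : GL σ k => ρ g v),
      fun g _ hy => apply_mem_span_orbit ρ v g hy⟩
  have hU : U.toSubmodule = Submodule.span k (Set.range fun g : GL σ k => ρ g v) := rfl
  have hss : ρ.IsSemisimpleRepresentation := isSemisimpleRepresentation_of_isRationalRep_holds hρ
  haveI : U.toRepresentation.IsIrreducible :=
    isIrreducible_toRepresentation_span_orbit hρ hss hv hv0 U hU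
  have hUrat : IsRationalRep U.toRepresentation := hρ.toRepresentation U
  have hvU : v ∈ U.toSubmodule :=
    Submodule.subset_span ⟨1, show ρ 1 v = v by rw [map_one, Module.End.one_apply]⟩
  set x : U.toSubmodule := ⟨v, hvU⟩ with hxdef
  have hx : x ∈ highestWeightSpace U.toRepresentation χ :=
    (mem_highestWeightSpace_toRepresentation_iff U χ x).mpr hv
  have hx0 : x ≠ 0 := fun h => hv0 (congrArg Subtype.val h)
  -- `W ≅ U` by the theorem of the highest weight
  obtain ⟨e⟩ := nonempty_equiv_of_mem_highestWeightSpace hW hUrat hv₀ hv₀0 hx hx0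
  set E : ρW.IntertwiningMap U.toRepresentation := e.toIntertwiningMap with hEdef
  have hEinj : Function.Injective E := EquivLike.injective e
  -- `E v₀` is a highest-weight vector of `U` of weight `χ`, hence `c • x` with `c ≠ 0`
  have hEv₀ : E v₀ ∈ highestWeightSpace U.toRepresentation χ :=
    highestWeightSpace_le_comap_intertwiningMap E χ hv₀
  obtain ⟨c, hc⟩ := Submodule.mem_span_singleton.mp
    (highestWeightSpace_le_span_singleton hUrat hx hx0 hEv₀)
  have hc0 : c ≠ 0 := by
    rintro rfl
    rw [zero_smul] at hc
    exact hv₀0 (hEinj (hc.symm.trans (map_zero E).symm))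
  -- the intertwiner `c⁻¹ • (U ↪ V) ∘ E`
  let incl : U.toRepresentation.IntertwiningMap ρ := ⟨U.toSubmodule.subtype, fun _ => rfl⟩
  refine ⟨c⁻¹ • incl.comp E, ?_⟩
  rw [Representation.IntertwiningMap.smul_apply, Representation.IntertwiningMap.comp_apply, ← hc]
  change c⁻¹ • (c • (x : V)) = v
  rw [smul_smul, inv_mul_cancel₀ hc0, one_smul]

end Extension

/-! ### The discharge -/

section Discharge

/-- **Multiplicity = dimension of intertwiners — discharge of the named fact
`hwMultiplicity_eq_finrank_intertwiningMap`** (`GLHighestWeight.lean`). For an irreducible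
rational representation `W` of `GL σ k` of highest weight `χ` and a finite-dimensional rational
representation `V` over an algebraically closed field of characteristic zero,
`hwMultiplicity ρ χ = dim V^B_χ = dim Hom_{GL}(W, V)`: evaluation at a nonzero highest-weight
vector `v₀ ∈ W`, `f ↦ f(v₀)`, is a linear bijection `Hom_{GL}(W, V) ≅ V^B_χ` — injective by
Schur's lemma (`Representation.IsIrreducible.injective_or_eq_zero`), surjective by
`exists_intertwiningMap_apply_eq`. Goodman–Wallach, proof of Thm. 4.2.12, eq. (4.26):
`mult_V(π^μ) = dim V^{𝔫⁺}(μ)`, with the multiplicity `m_V(λ) = dim Hom_𝒜(F^λ, V)` of §4.1.6.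
[cite: GoodmanWallachGTM255, Thm. 4.2.12, eq. (4.26), with §4.1.6] -/
theorem hwMultiplicity_eq_finrank_intertwiningMap_holds :
    hwMultiplicity_eq_finrank_intertwiningMap (σ := σ) (k := k) (V := V) (W := W) := by
  intro _ _ _ _ ρW _ hW χ hWχ ρ hρ
  obtain ⟨v₀, hv₀0, hv₀⟩ := (hasHighestWeight_iff_exists _ _).mp hWχ
  -- evaluation at `v₀`
  let ev : ρW.IntertwiningMap ρ →ₗ[k] highestWeightSpace ρ χ :=
    { toFun := fun f => ⟨f v₀, highestWeightSpace_le_comap_intertwiningMap f χ hv₀⟩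
      map_add' := fun _ _ => rfl
      map_smul' := fun _ _ => rfl }
  have hinj : Function.Injective ev := by
    refine (injective_iff_map_eq_zero ev).mpr fun f hf => ?_
    have hf0 : f v₀ = 0 := congrArg Subtype.val hf
    rcases Representation.IsIrreducible.injective_or_eq_zero f with h | h
    · exact absurd (h (hf0.trans (map_zero f).symm)) hv₀0
    · exact h
  have hsurj : Function.Surjective ev := by
    rintro ⟨v, hv⟩
    by_cases hv0 : v = 0
    · refine ⟨0, Subtype.ext ?_⟩
      change (0 : ρW.IntertwiningMap ρ) v₀ = v
      rw [hv0]
      rfl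
    · obtain ⟨f, hf⟩ := exists_intertwiningMap_apply_eq hW hv₀ hv₀0 hρ hv hv0
      exact ⟨f, Subtype.ext hf⟩
  rw [hwMultiplicity]
  exact (LinearEquiv.finrank_eq (LinearEquiv.ofBijective ev ⟨hinj, hsurj⟩)).symm

end Discharge

end Literature.NumberTheory.DiophantineGeometry
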